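import Summits.Ventures.Crystal3D.Theorems.StickyWulffConstantCoaxialWallLawLensCapacity
import HarnessLib

/-!
# LEMMA HEX: six exact in-plane neighbours confine the loose witnesses to two `35.26°` polar caps, at most two per side
# (crux `CoaxialWallLaw`, stmt-Ventures-19481; cf-p1 DECISION (cxliii)(3): pattern lemmas for cf-p2's capacity table (69.0⁶), kind = lemma entries)

HONEST FRAMING. Venture `Summits/Ventures/Crystal3D` (cell `crystal3d-full`); helper `--supports` the crux `CoaxialWallLaw`
(stmt-Ventures-19481, `route-Ventures-StickyWulffConstant`), registered line 'CoaxialWallLawCertificates' (planner cf-p1).  Census-free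
geometry in `E³`; F-C1 not moved.  SETTING (cf-p2 HOME/cf-p2/fcert/t3/dust/CAPACITY-PROPOSED.md «LEMMA HEX»): a host `y` whose six in-plane
neighbours `y ± a, y ± b, y ± (b − a)` are exact balls (`a, b` unit, `⟪a, b⟫ = ½`: a lattice hexagon); `n` a unit normal of the plane.  A ball `x`
touching `y` that overlaps none of the six has direction `u = x − y` with `|⟪u, h⟫| ≤ ½` for the three hexagon axes `h ∈ {a, b, b − a}` («hex-free»).
* `hexagon_bound`, `hexagon_vertex` — the planar hexagon `{|P₀|, |P₁|, |P₁ − P₀| ≤ ½}` has `P₀² − P₀P₁ + P₁² ≤ ¼`, with equality exactly at its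
  six vertices;
* `hex_cap_coeffs` — in the basis `(a, b, T)` (`T` the apex `(a + b)/3 + √(2/3) n`) a hex-free unit vector has `T`-coefficient `ν` with `ν² ≥ 1`;
* **`inner_normal_sq_ge_of_hexFree`** (HEX-A) — a hex-free unit direction satisfies `⟪u, n⟫² ≥ 2/3`: colatitude `≤ 35.26°` from the axis
  (witnesses live in the two polar caps);
* **`hollow_of_three_hexFree`** (HEX-B) — three hex-free unit directions on one side (`⟪uᵢ, n⟫ > 0`) pairwise `≥ 60°` apart are all HOLLOW
  directions: `⟪uᵢ, n⟫ = √(2/3)` and `3uᵢ − √6 n ∈ {a + b, 2b − a, b − 2a, −(a + b), a − 2b, 2a − b}` (the next-layer sites of the two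
  stackings — module sites or apex positions, i.e. FORBIDDEN for loose witnesses); equivalently **`no_three_hexFree_offHollow`**: at most TWO
  loose witnesses per open side (for a hex-free `u`, `⟪u, n⟫ = √(2/3)` iff `u` is a hollow direction, by `hexagon_vertex`).  With one / two
  exact polar contacts `c, c'` on a side (they are hex-free unit directions themselves, and a loose witness stays `≥ 60°` from them) the SAME
  lemma applied to `(u, u', c)` / `(u, c, c')` leaves `≤ 1` / `0` witnesses on that side (capacity-table entries «ring + 1 polar», «ring + 2», E0).
Proofs: `…LensCapacity`'s basis `(a, b, T)` (`exists_coeffs`, `inner_combo`, `apex_facts`); HEX-B by `‖u₁+u₂+u₃‖² ≤ 6` against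
`⟪u₁+u₂+u₃, n⟫ ≥ 3√(2/3) = √6`, forcing every inequality to be an equality.
WHAT THIS IS NOT: no statement about types or certificates; F-C1 not moved.
-/

noncomputable section

namespace Summit.Ventures.Crystal3D.Theorems

namespace HexCap

open Summit.Ventures.Crystal3D Module LensCapacity
open scoped InnerProductSpace

/-! ### The planar hexagon -/

/-- **The hexagon bound**: `|P₀|, |P₁|, |P₁ − P₀| ≤ ½ ⇒ P₀² − P₀P₁ + P₁² ≤ ¼` (the hexagon of inradius `½` has circumradius `1/√3`). -/
theorem hexagon_bound {P₀ P₁ : ℝ} (h0 : |P₀| ≤ 1 / 2) (h1 : |P₁| ≤ 1 / 2) (h2 : |P₁ - P₀| ≤ 1 / 2) :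
    P₀ ^ 2 - P₀ * P₁ + P₁ ^ 2 ≤ 1 / 4 := by
  rw [abs_le] at h0 h1 h2
  rcases le_total 0 P₀ with hp | hp <;> rcases le_total 0 P₁ with hq | hq
  · rcases le_total P₀ P₁ with hle | hle
    · nlinarith [mul_nonneg hp (sub_nonneg.2 hle)]
    · nlinarith [mul_nonneg hq (sub_nonneg.2 hle)]
  · nlinarith [mul_nonneg hp (neg_nonneg.2 hq)]
  · nlinarith [mul_nonneg (neg_nonneg.2 hp) hq]
  · rcases le_total P₀ P₁ with hle | hle
    · nlinarith [mul_nonneg (neg_nonneg.2 hq) (sub_nonneg.2 hle)]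
    · nlinarith [mul_nonneg (neg_nonneg.2 hp) (sub_nonneg.2 hle)]

/-- **Equality in the hexagon bound holds exactly at the six vertices.** -/
theorem hexagon_vertex {P₀ P₁ : ℝ} (h0 : |P₀| ≤ 1 / 2) (h1 : |P₁| ≤ 1 / 2) (h2 : |P₁ - P₀| ≤ 1 / 2)
    (heq : P₀ ^ 2 - P₀ * P₁ + P₁ ^ 2 = 1 / 4) :
    (P₀ = 1 / 2 ∧ P₁ = 1 / 2) ∨ (P₀ = 0 ∧ P₁ = 1 / 2) ∨ (P₀ = -(1 / 2) ∧ P₁ = 0) ∨ (P₀ = -(1 / 2) ∧ P₁ = -(1 / 2)) ∨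
      (P₀ = 0 ∧ P₁ = -(1 / 2)) ∨ (P₀ = 1 / 2 ∧ P₁ = 0) := by
  rw [abs_le] at h0 h1 h2
  rcases le_total 0 P₀ with hp | hp <;> rcases le_total 0 P₁ with hq | hq
  · -- both nonnegative: `E = max² + min (min − max)·… `; equality forces max = ½ and min ∈ {0, max}
    rcases le_total P₀ P₁ with hle | hle
    · have hA : 0 ≤ P₀ * (P₁ - P₀) := mul_nonneg hp (sub_nonneg.2 hle)
      have hB : 0 ≤ 1 / 4 - P₁ ^ 2 := by nlinarith
      have hA0 : P₀ * (P₁ - P₀) = 0 := by nlinarith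
      have hB0 : P₁ ^ 2 = 1 / 4 := by nlinarith
      have hP₁ : P₁ = 1 / 2 := by nlinarith
      rcases mul_eq_zero.1 hA0 with h | h
      · exact Or.inr (Or.inl ⟨h, hP₁⟩)
      · exact Or.inl ⟨by linarith, hP₁⟩
    · have hA : 0 ≤ P₁ * (P₀ - P₁) := mul_nonneg hq (sub_nonneg.2 hle)
      have hA0 : P₁ * (P₀ - P₁) = 0 := by nlinarith
      have hP₀ : P₀ = 1 / 2 := by nlinarith
      rcases mul_eq_zero.1 hA0 with h | h
      · exact Or.inr (Or.inr (Or.inr (Or.inr (Or.inr ⟨hP₀, h⟩))))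
      · exact Or.inl ⟨hP₀, by linarith⟩
  · -- `P₀ ≥ 0 ≥ P₁`: `E = (P₀ − P₁)² + P₀P₁`, equality forces `P₀ − P₁ = ½` and `P₀P₁ = 0`
    have hA : P₀ * P₁ ≤ 0 := mul_nonpos_of_nonneg_of_nonpos hp hq
    have hA0 : P₀ * P₁ = 0 := by nlinarith
    have hD : P₀ - P₁ = 1 / 2 := by nlinarith
    rcases mul_eq_zero.1 hA0 with h | h
    · exact Or.inr (Or.inr (Or.inr (Or.inr (Or.inl ⟨h, by linarith⟩))))
    · exact Or.inr (Or.inr (Or.inr (Or.inr (Or.inr ⟨by linarith, h⟩))))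
  · have hA : P₀ * P₁ ≤ 0 := mul_nonpos_of_nonpos_of_nonneg hp hq
    have hA0 : P₀ * P₁ = 0 := by nlinarith
    have hD : P₁ - P₀ = 1 / 2 := by nlinarith
    rcases mul_eq_zero.1 hA0 with h | h
    · exact Or.inr (Or.inl ⟨h, by linarith⟩)
    · exact Or.inr (Or.inr (Or.inl ⟨by linarith, h⟩))
  · rcases le_total P₀ P₁ with hle | hle
    · have hA : 0 ≤ -P₁ * (P₁ - P₀) := mul_nonneg (neg_nonneg.2 hq) (sub_nonneg.2 hle)
      have hA0 : -P₁ * (P₁ - P₀) = 0 := by nlinarith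
      have hP₀ : P₀ = -(1 / 2) := by nlinarith
      rcases mul_eq_zero.1 hA0 with h | h
      · exact Or.inr (Or.inr (Or.inl ⟨hP₀, by linarith⟩))
      · exact Or.inr (Or.inr (Or.inr (Or.inl ⟨hP₀, by linarith⟩)))
    · have hA : 0 ≤ -P₀ * (P₀ - P₁) := mul_nonneg (neg_nonneg.2 hp) (sub_nonneg.2 hle)
      have hA0 : -P₀ * (P₀ - P₁) = 0 := by nlinarith
      have hP₁ : P₁ = -(1 / 2) := by nlinarith
      rcases mul_eq_zero.1 hA0 with h | h
      · exact Or.inr (Or.inr (Or.inr (Or.inr (Or.inl ⟨by linarith, hP₁⟩))))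
      · exact Or.inr (Or.inr (Or.inr (Or.inl ⟨by linarith, hP₁⟩)))

/-- **HEX cap in coefficients**: for `u = l•a + m•b + ν•T` with `P₀ = ⟪u, a⟫ = l + m/2 + ν/2`, `P₁ = ⟪u, b⟫ = l/2 + m + ν/2` in the hexagon and
`‖u‖² = l² + m² + ν² + lm + lν + mν = 1`: `ν² ≥ 1` (since `‖u‖² = (4/3)(P₀² − P₀P₁ + P₁²) + (2/3)ν²`). -/
theorem hex_cap_coeffs {l m ν : ℝ} (h0 : |l + m / 2 + ν / 2| ≤ 1 / 2) (h1 : |l / 2 + m + ν / 2| ≤ 1 / 2)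
    (h2 : |l / 2 + m + ν / 2 - (l + m / 2 + ν / 2)| ≤ 1 / 2) (hQ : l ^ 2 + m ^ 2 + ν ^ 2 + l * m + l * ν + m * ν = 1) : 1 ≤ ν ^ 2 := by
  have hE := hexagon_bound h0 h1 h2
  nlinarith [hE]

/-! ### The hexagonal frame in `E³` -/

section Frame

variable {a b n : EuclideanSpace ℝ (Fin 3)} (ha : ‖a‖ = 1) (hb : ‖b‖ = 1) (hn : ‖n‖ = 1) (hab : ⟪a, b⟫_ℝ = 1 / 2)
  (hna : ⟪n, a⟫_ℝ = 0) (hnb : ⟪n, b⟫_ℝ = 0)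

include ha hb hn hab hna hnb

/-- The apex `T = (a + b)/3 + √(2/3) n` of the frame: unit, at `60°` from `a` and `b`, `⟪n, T⟫ = √(2/3)`. -/
theorem apex_facts_unit :
    ‖(1 / 3 : ℝ) • a + (1 / 3 : ℝ) • b + Real.sqrt (2 / 3) • n‖ = 1 ∧ ⟪a, (1 / 3 : ℝ) • a + (1 / 3 : ℝ) • b + Real.sqrt (2 / 3) • n⟫_ℝ = 1 / 2 ∧
      ⟪b, (1 / 3 : ℝ) • a + (1 / 3 : ℝ) • b + Real.sqrt (2 / 3) • n⟫_ℝ = 1 / 2 ∧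
      ⟪n, (1 / 3 : ℝ) • a + (1 / 3 : ℝ) • b + Real.sqrt (2 / 3) • n⟫_ℝ = Real.sqrt (2 / 3) := by
  have hκ : Real.sqrt (2 / 3) ^ 2 * ‖n‖ ^ 2 = 2 / 3 := by rw [Real.sq_sqrt (by norm_num), hn]; norm_num
  obtain ⟨h1, h2, h3, h4⟩ := apex_facts ha hb hab hna hnb hκ
  refine ⟨h1, h2, h3, ?_⟩
  rw [h4, hn]; ring

/-- **HEX-A (the polar caps).**  A unit direction `u` that is hex-free (`|⟪u, a⟫|, |⟪u, b⟫|, |⟪u, b − a⟫| ≤ ½`, i.e. the ball `y + u` overlaps none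
of the six exact in-plane neighbours of `y`) satisfies `⟪u, n⟫² ≥ 2/3`: it lies within `35.26°` of the hexagon axis. -/
theorem inner_normal_sq_ge_of_hexFree {u : EuclideanSpace ℝ (Fin 3)} (hu : ‖u‖ = 1) (hua : |⟪u, a⟫_ℝ| ≤ 1 / 2) (hub : |⟪u, b⟫_ℝ| ≤ 1 / 2)
    (huba : |⟪u, b - a⟫_ℝ| ≤ 1 / 2) : 2 / 3 ≤ ⟪u, n⟫_ℝ ^ 2 := by
  obtain ⟨hT, haT, hbT, hnT⟩ := apex_facts_unit ha hb hn hab hna hnb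
  set T := (1 / 3 : ℝ) • a + (1 / 3 : ℝ) • b + Real.sqrt (2 / 3) • n with hTdef
  obtain ⟨l, m, ν, rfl⟩ := exists_coeffs ha hb hT hab haT hbT u
  obtain ⟨h0, h1, -, hQ⟩ := inner_combo ha hb hT hab haT hbT l m ν
  have han : ⟪a, n⟫_ℝ = 0 := by rw [real_inner_comm]; exact hna
  have hbn : ⟪b, n⟫_ℝ = 0 := by rw [real_inner_comm]; exact hnb
  have hun : ⟪l • a + m • b + ν • T, n⟫_ℝ = ν * Real.sqrt (2 / 3) := by
    simp only [inner_add_left, real_inner_smul_left, han, hbn]; rw [real_inner_comm, hnT]; ring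
  have hdiff : ⟪l • a + m • b + ν • T, b - a⟫_ℝ = (l / 2 + m + ν / 2) - (l + m / 2 + ν / 2) := by rw [inner_sub_right, h0, h1]
  rw [h0] at hua; rw [h1] at hub; rw [hdiff] at huba; rw [hu] at hQ
  have hν := hex_cap_coeffs hua hub huba (by linarith [hQ])
  rw [hun, mul_pow, Real.sq_sqrt (by norm_num)]
  nlinarith [hν]

/-- A hex-free unit direction on the `+` side has `T`-side inner product `⟪u, n⟫ ≥ √(2/3)`. -/
theorem inner_normal_ge_of_hexFree {u : EuclideanSpace ℝ (Fin 3)} (hu : ‖u‖ = 1) (hua : |⟪u, a⟫_ℝ| ≤ 1 / 2) (hub : |⟪u, b⟫_ℝ| ≤ 1 / 2)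
    (huba : |⟪u, b - a⟫_ℝ| ≤ 1 / 2) (hpos : 0 < ⟪u, n⟫_ℝ) : Real.sqrt (2 / 3) ≤ ⟪u, n⟫_ℝ := by
  have h := inner_normal_sq_ge_of_hexFree ha hb hn hab hna hnb hu hua hub huba
  have hs : Real.sqrt (2 / 3) ^ 2 = 2 / 3 := Real.sq_sqrt (by norm_num)
  have hs0 : 0 ≤ Real.sqrt (2 / 3) := Real.sqrt_nonneg _
  nlinarith [h, hs, hs0, hpos]

/-- **HEX-B (three on one side are the three hollows).**  Three hex-free unit directions on the `+` side of the plane, pairwise `≥ 60°` apart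
(`⟪uᵢ, uⱼ⟫ ≤ ½`, i.e. three `1`-separated balls touching `y`), are HOLLOW directions: each has `⟪uᵢ, n⟫ = √(2/3)` and planar part a hexagon vertex,
i.e. `3uᵢ − √6 n ∈ {a + b, 2b − a, b − 2a, −(a + b), a − 2b, 2a − b}` — the next-layer site directions of the two stackings over the hexagon. -/
theorem hollow_of_three_hexFree {u₁ u₂ u₃ : EuclideanSpace ℝ (Fin 3)}
    (hu₁ : ‖u₁‖ = 1) (h₁a : |⟪u₁, a⟫_ℝ| ≤ 1 / 2) (h₁b : |⟪u₁, b⟫_ℝ| ≤ 1 / 2) (h₁ba : |⟪u₁, b - a⟫_ℝ| ≤ 1 / 2) (h₁n : 0 < ⟪u₁, n⟫_ℝ)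
    (hu₂ : ‖u₂‖ = 1) (h₂a : |⟪u₂, a⟫_ℝ| ≤ 1 / 2) (h₂b : |⟪u₂, b⟫_ℝ| ≤ 1 / 2) (h₂ba : |⟪u₂, b - a⟫_ℝ| ≤ 1 / 2) (h₂n : 0 < ⟪u₂, n⟫_ℝ)
    (hu₃ : ‖u₃‖ = 1) (h₃a : |⟪u₃, a⟫_ℝ| ≤ 1 / 2) (h₃b : |⟪u₃, b⟫_ℝ| ≤ 1 / 2) (h₃ba : |⟪u₃, b - a⟫_ℝ| ≤ 1 / 2) (h₃n : 0 < ⟪u₃, n⟫_ℝ)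
    (h₁₂ : ⟪u₁, u₂⟫_ℝ ≤ 1 / 2) (h₁₃ : ⟪u₁, u₃⟫_ℝ ≤ 1 / 2) (h₂₃ : ⟪u₂, u₃⟫_ℝ ≤ 1 / 2) :
    ⟪u₁, n⟫_ℝ = Real.sqrt (2 / 3) ∧
      ((3 : ℝ) • u₁ - Real.sqrt 6 • n = a + b ∨ (3 : ℝ) • u₁ - Real.sqrt 6 • n = (2 : ℝ) • b - a ∨ (3 : ℝ) • u₁ - Real.sqrt 6 • n = b - (2 : ℝ) • a ∨
        (3 : ℝ) • u₁ - Real.sqrt 6 • n = -(a + b) ∨ (3 : ℝ) • u₁ - Real.sqrt 6 • n = a - (2 : ℝ) • b ∨ (3 : ℝ) • u₁ - Real.sqrt 6 • n = (2 : ℝ) • a - b) := by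
  have g₁ := inner_normal_ge_of_hexFree ha hb hn hab hna hnb hu₁ h₁a h₁b h₁ba h₁n
  have g₂ := inner_normal_ge_of_hexFree ha hb hn hab hna hnb hu₂ h₂a h₂b h₂ba h₂n
  have g₃ := inner_normal_ge_of_hexFree ha hb hn hab hna hnb hu₃ h₃a h₃b h₃ba h₃n
  have hs : Real.sqrt (2 / 3) ^ 2 = 2 / 3 := Real.sq_sqrt (by norm_num)
  have hs0 : 0 ≤ Real.sqrt (2 / 3) := Real.sqrt_nonneg _
  -- the sum `s = u₁ + u₂ + u₃`: `‖s‖² ≤ 6` and `⟪s, n⟫ ≥ 3√(2/3)`, while `⟪s, n⟫² ≤ ‖s‖² ‖n‖²`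
  have h11 : ⟪u₁, u₁⟫_ℝ = 1 := by rw [real_inner_self_eq_norm_sq, hu₁]; norm_num
  have h22 : ⟪u₂, u₂⟫_ℝ = 1 := by rw [real_inner_self_eq_norm_sq, hu₂]; norm_num
  have h33 : ⟪u₃, u₃⟫_ℝ = 1 := by rw [real_inner_self_eq_norm_sq, hu₃]; norm_num
  have hss : ‖u₁ + u₂ + u₃‖ ^ 2 = 3 + 2 * (⟪u₁, u₂⟫_ℝ + ⟪u₁, u₃⟫_ℝ + ⟪u₂, u₃⟫_ℝ) := by
    rw [← real_inner_self_eq_norm_sq]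
    simp only [inner_add_left, inner_add_right, h11, h22, h33, real_inner_comm u₁ u₂, real_inner_comm u₁ u₃, real_inner_comm u₂ u₃]
    ring
  have hsn : ⟪u₁ + u₂ + u₃, n⟫_ℝ = ⟪u₁, n⟫_ℝ + ⟪u₂, n⟫_ℝ + ⟪u₃, n⟫_ℝ := by simp only [inner_add_left]
  have hcs : ⟪u₁ + u₂ + u₃, n⟫_ℝ ≤ ‖u₁ + u₂ + u₃‖ := by
    have := real_inner_le_norm (u₁ + u₂ + u₃) n; rw [hn, mul_one] at this; exact this
  have hcs2 : ⟪u₁ + u₂ + u₃, n⟫_ℝ ^ 2 ≤ ‖u₁ + u₂ + u₃‖ ^ 2 := by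
    have h0 : 0 ≤ ⟪u₁ + u₂ + u₃, n⟫_ℝ := by rw [hsn]; linarith
    nlinarith [hcs, h0]
  rw [hsn, hss] at hcs2
  -- all equalities: ⟪uᵢ, n⟫ = √(2/3)
  have hX : (⟪u₁, n⟫_ℝ + ⟪u₂, n⟫_ℝ + ⟪u₃, n⟫_ℝ) ^ 2 ≤ 9 * Real.sqrt (2 / 3) ^ 2 := by rw [hs]; linarith only [hcs2, h₁₂, h₁₃, h₂₃]
  have hle : ⟪u₁, n⟫_ℝ + ⟪u₂, n⟫_ℝ + ⟪u₃, n⟫_ℝ ≤ 3 * Real.sqrt (2 / 3) := by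
    by_contra hgt
    push Not at hgt
    have hd : 0 < ⟪u₁, n⟫_ℝ + ⟪u₂, n⟫_ℝ + ⟪u₃, n⟫_ℝ - 3 * Real.sqrt (2 / 3) := by linarith only [hgt]
    nlinarith only [hX, mul_pos hd hd, mul_nonneg hs0 hd.le]
  have e₁ : ⟪u₁, n⟫_ℝ = Real.sqrt (2 / 3) := by linarith only [hle, g₁, g₂, g₃]
  refine ⟨e₁, ?_⟩
  -- decompose `u₁` and identify the planar part as a hexagon vertex
  obtain ⟨hT, haT, hbT, hnT⟩ := apex_facts_unit ha hb hn hab hna hnb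
  set T := (1 / 3 : ℝ) • a + (1 / 3 : ℝ) • b + Real.sqrt (2 / 3) • n with hTdef
  obtain ⟨l, m, ν, hu⟩ := exists_coeffs ha hb hT hab haT hbT u₁
  obtain ⟨h0, h1, -, hQ⟩ := inner_combo ha hb hT hab haT hbT l m ν
  have han : ⟪a, n⟫_ℝ = 0 := by rw [real_inner_comm]; exact hna
  have hbn : ⟪b, n⟫_ℝ = 0 := by rw [real_inner_comm]; exact hnb
  have hun : ⟪l • a + m • b + ν • T, n⟫_ℝ = ν * Real.sqrt (2 / 3) := by
    simp only [inner_add_left, real_inner_smul_left, han, hbn]; rw [real_inner_comm, hnT]; ring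
  rw [hu] at e₁ h₁a h₁b h₁ba hu₁
  rw [hun] at e₁
  have hspos : 0 < Real.sqrt (2 / 3) := Real.sqrt_pos.2 (by norm_num)
  have hν : ν = 1 := by
    have h1' : (ν - 1) * Real.sqrt (2 / 3) = 0 := by linear_combination e₁
    exact sub_eq_zero.1 ((mul_eq_zero.1 h1').resolve_right hspos.ne')
  have hdiff : ⟪l • a + m • b + ν • T, b - a⟫_ℝ = (l / 2 + m + ν / 2) - (l + m / 2 + ν / 2) := by rw [inner_sub_right, h0, h1]
  rw [h0] at h₁a; rw [h1] at h₁b; rw [hdiff] at h₁ba; rw [hu₁] at hQ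
  subst hν
  -- `E = ¼`
  have hE : (l + m / 2 + 1 / 2) ^ 2 - (l + m / 2 + 1 / 2) * (l / 2 + m + 1 / 2) + (l / 2 + m + 1 / 2) ^ 2 = 1 / 4 := by
    linear_combination (-(3 / 4) : ℝ) * hQ
  have hv := hexagon_vertex h₁a h₁b h₁ba hE
  -- `3 u₁ − √6 n = 3 (l + 1/3) a + 3 (m + 1/3) b`
  have hsq6 : Real.sqrt 6 = 3 * Real.sqrt (2 / 3) := by
    rw [show (6 : ℝ) = 3 ^ 2 * (2 / 3) by norm_num, Real.sqrt_mul (by norm_num), Real.sqrt_sq (by norm_num)]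
  have hred : (3 : ℝ) • (l • a + m • b + (1 : ℝ) • T) - Real.sqrt 6 • n = (3 * l + 1) • a + (3 * m + 1) • b := by
    rw [hsq6, hTdef]
    module
  rw [hu, hred]
  rcases hv with ⟨hp, hq⟩ | ⟨hp, hq⟩ | ⟨hp, hq⟩ | ⟨hp, hq⟩ | ⟨hp, hq⟩ | ⟨hp, hq⟩
  · left
    have hl : 3 * l + 1 = 1 := by linarith only [hp, hq]
    have hm : 3 * m + 1 = 1 := by linarith only [hp, hq]
    rw [hl, hm, one_smul, one_smul]
  · right; left
    have hl : 3 * l + 1 = -1 := by linarith only [hp, hq]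
    have hm : 3 * m + 1 = 2 := by linarith only [hp, hq]
    rw [hl, hm]; module
  · right; right; left
    have hl : 3 * l + 1 = -2 := by linarith only [hp, hq]
    have hm : 3 * m + 1 = 1 := by linarith only [hp, hq]
    rw [hl, hm]; module
  · right; right; right; left
    have hl : 3 * l + 1 = -1 := by linarith only [hp, hq]
    have hm : 3 * m + 1 = -1 := by linarith only [hp, hq]
    rw [hl, hm]; module
  · right; right; right; right; left
    have hl : 3 * l + 1 = 1 := by linarith only [hp, hq]
    have hm : 3 * m + 1 = -2 := by linarith only [hp, hq]
    rw [hl, hm]; module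
  · right; right; right; right; right
    have hl : 3 * l + 1 = 2 := by linarith only [hp, hq]
    have hm : 3 * m + 1 = -1 := by linarith only [hp, hq]
    rw [hl, hm]; module

/-- **At most two loose witnesses per open side**: three hex-free unit directions on one side, pairwise `≥ 60°` apart, one of which is NOT a hollow
direction, do not exist.  (A loose witness is never at a hollow: the hollows are module sites or apex positions.) -/
theorem no_three_hexFree_offHollow {u₁ u₂ u₃ : EuclideanSpace ℝ (Fin 3)}
    (hu₁ : ‖u₁‖ = 1) (h₁a : |⟪u₁, a⟫_ℝ| ≤ 1 / 2) (h₁b : |⟪u₁, b⟫_ℝ| ≤ 1 / 2) (h₁ba : |⟪u₁, b - a⟫_ℝ| ≤ 1 / 2) (h₁n : 0 < ⟪u₁, n⟫_ℝ)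
    (hu₂ : ‖u₂‖ = 1) (h₂a : |⟪u₂, a⟫_ℝ| ≤ 1 / 2) (h₂b : |⟪u₂, b⟫_ℝ| ≤ 1 / 2) (h₂ba : |⟪u₂, b - a⟫_ℝ| ≤ 1 / 2) (h₂n : 0 < ⟪u₂, n⟫_ℝ)
    (hu₃ : ‖u₃‖ = 1) (h₃a : |⟪u₃, a⟫_ℝ| ≤ 1 / 2) (h₃b : |⟪u₃, b⟫_ℝ| ≤ 1 / 2) (h₃ba : |⟪u₃, b - a⟫_ℝ| ≤ 1 / 2) (h₃n : 0 < ⟪u₃, n⟫_ℝ)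
    (h₁₂ : ⟪u₁, u₂⟫_ℝ ≤ 1 / 2) (h₁₃ : ⟪u₁, u₃⟫_ℝ ≤ 1 / 2) (h₂₃ : ⟪u₂, u₃⟫_ℝ ≤ 1 / 2)
    (hoff : ⟪u₁, n⟫_ℝ ≠ Real.sqrt (2 / 3)) : False :=
  hoff (hollow_of_three_hexFree ha hb hn hab hna hnb hu₁ h₁a h₁b h₁ba h₁n hu₂ h₂a h₂b h₂ba h₂n hu₃ h₃a h₃b h₃ba h₃n h₁₂ h₁₃ h₂₃).1

end Frame

end HexCap

end Summit.Ventures.Crystal3D.Theorems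

end
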